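import Mathlib
import Summits.Ventures.HodgeRepro2.Tier7.Line1.SepWeightFix
import Summits.Ventures.HodgeRepro2.Tier7.Line1.SepCurveAut

/-!
# Tier7/Line1/SepAlgebra — the cohomology algebra `HXS` of the separating datum

The SEPARATING DATUM of t7-L1-p2 (LINE L1, residual probe), algebraic half. `U := Wmod 0 ⊔ Wmod sq` (the two
restricted tensor products of `SepWeight`, `sq n = 2^{-(n+1)}`) sits in `ℓ²(Finset ℕ)` through `toLp`; the bilinear
form `Bform u w = ∑_ω u ω * w ω` (= `⟪star (toLp u), toLp w⟫`) is invariant under the flips and signs. The «first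
curve» is `A₁ := Curve ℂ (U × U) Unit β₁` (holomorphic and antiholomorphic copies of `U`, paired by `Bform`), the
«second curve» has `V₂ := (Fin 2 → A₁) × (Fin 2 → A₁)` (two holomorphic classes `e₀, e₁`, their conjugates, paired by
`β₂`), and `HXS J := Curve A₁ V₂ (Junk J) β₂` (a square-zero junk summand `J` for the injectivity of the Albanese map).
This file: the forms, the algebras, their commutativity, the augmentation, the junk module structure.
Author: t7-L1-p2 (prover-pub-hodge-repro2-t7-L1-p2-g0-0). §8(d): NO.
-/

namespace Summit.Ventures.HodgeRepro2.Tier7.Line1.Sep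

open Finset

noncomputable section

/-! ## The weight `sq` and the space `U` -/

/-- the weight sequence `sq n = 2^{-(n+1)}` (real, non-zero, square-summable) -/
def sq : ℕ → ℂ := fun n => (((1 / 2 : ℝ) ^ (n + 1) : ℝ) : ℂ)

/-- `sq n ≠ 0` -/
theorem sq_ne_zero (n : ℕ) : sq n ≠ 0 := by
  simp only [sq, ne_eq, Complex.ofReal_eq_zero]
  positivity

/-- `sq` is real -/
theorem conj_sq (n : ℕ) : (starRingEnd ℂ) (sq n) = sq n := by
  simp only [sq]; exact Complex.conj_ofReal _

/-- `∑ ‖sq n‖² < ∞` -/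
theorem summable_sq_sq : Summable fun n => ‖sq n‖ ^ 2 := by
  have h : ∀ n, ‖sq n‖ ^ 2 = (1 / 4 : ℝ) ^ n * (1 / 4 : ℝ) := by
    intro n
    have h1 : ‖sq n‖ = (1 / 2 : ℝ) ^ (n + 1) := by
      simp only [sq, Complex.norm_real, Real.norm_eq_abs]
      exact abs_of_nonneg (by positivity)
    rw [h1, ← pow_mul, Nat.mul_comm (n + 1) 2, pow_mul, pow_succ]
    norm_num
  simp_rw [h]
  exact (summable_geometric_of_lt_one (by norm_num) (by norm_num)).mul_right _

/-- `∑ ‖(0 : ℕ → ℂ) n‖² < ∞` -/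
theorem summable_zero_sq : Summable fun n => ‖(0 : ℕ → ℂ) n‖ ^ 2 := by
  simp

/-- `U = Wmod 0 ⊔ Wmod sq`, the span of the two restricted tensor products -/
def Usub : Submodule ℂ (Ω → ℂ) := Wmod 0 ⊔ Wmod sq

/-- `U` as a type -/
abbrev U := ↥Usub

/-- `Wmod 0 ≤ U` -/
theorem Wmod_zero_le_Usub : Wmod 0 ≤ Usub := le_sup_left

/-- `Wmod sq ≤ U` -/
theorem Wmod_sq_le_Usub : Wmod sq ≤ Usub := le_sup_right

/-- every element of `U` is square-summable -/
theorem memℓp_of_mem_Usub {f : Ω → ℂ} (hf : f ∈ Usub) : Memℓp f 2 := by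
  obtain ⟨a, ha, b, hb, rfl⟩ := Submodule.mem_sup.1 hf
  exact (memℓp_of_mem_Wmod summable_zero_sq ha).add (memℓp_of_mem_Wmod summable_sq_sq hb)

/-- `U` is stable under the flips -/
theorem flip_mem_Usub (n : ℕ) {f : Ω → ℂ} (hf : f ∈ Usub) : flip n f ∈ Usub := by
  obtain ⟨a, ha, b, hb, rfl⟩ := Submodule.mem_sup.1 hf
  rw [flip_add]
  exact Submodule.mem_sup.2 ⟨_, (Wmod_stable 0).flip_mem n a ha, _, (Wmod_stable sq).flip_mem n b hb, rfl⟩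

/-- `U` is stable under the signs -/
theorem sgn_mem_Usub (n : ℕ) {f : Ω → ℂ} (hf : f ∈ Usub) : sgn n f ∈ Usub := by
  obtain ⟨a, ha, b, hb, rfl⟩ := Submodule.mem_sup.1 hf
  rw [sgn_add]
  exact Submodule.mem_sup.2 ⟨_, (Wmod_stable 0).sgn_mem n a ha, _, (Wmod_stable sq).sgn_mem n b hb, rfl⟩

/-- `U` is stable under conjugation -/
theorem conjF_mem_Usub {f : Ω → ℂ} (hf : f ∈ Usub) : conjF f ∈ Usub := by
  obtain ⟨a, ha, b, hb, rfl⟩ := Submodule.mem_sup.1 hf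
  rw [conjF_add]
  exact Submodule.mem_sup.2 ⟨_, conjF_mem_Wmod (fun n => by simp) ha, _, conjF_mem_Wmod conj_sq hb, rfl⟩

/-! ## The `ℓ²` embedding and the bilinear form -/

/-- the `ℓ²` space on the configurations -/
abbrev L2Ω := lp (fun _ : Ω => ℂ) 2

/-- the embedding `U → ℓ²(Ω)` -/
def toLp : U →ₗ[ℂ] L2Ω where
  toFun u := ⟨(u : Ω → ℂ), memℓp_of_mem_Usub u.2⟩
  map_add' _ _ := rfl
  map_smul' _ _ := rfl

/-- `toLp` unfolded -/
@[simp] theorem toLp_apply (u : U) (ω : Ω) : (toLp u : Ω → ℂ) ω = (u : Ω → ℂ) ω := rfl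

/-- `toLp` is injective -/
theorem toLp_injective : Function.Injective toLp := by
  intro u w h
  ext ω
  exact congrFun (congrArg Subtype.val h) ω

/-- the bilinear form `Bform u w = ∑_ω u ω * w ω` -/
def Bform : U →ₗ[ℂ] U →ₗ[ℂ] ℂ :=
  LinearMap.mk₂ ℂ (fun u w => inner ℂ (star (toLp u)) (toLp w))
    (fun u u' w => by rw [map_add, star_add, inner_add_left])
    (fun c u w => by rw [map_smul, star_smul, inner_smul_left, Complex.star_def, Complex.conj_conj, smul_eq_mul])
    (fun u w w' => by rw [map_add, inner_add_right])
    (fun c u w => by rw [map_smul, inner_smul_right, smul_eq_mul])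

/-- `Bform` unfolded -/
theorem Bform_apply (u w : U) : Bform u w = inner ℂ (star (toLp u)) (toLp w) := rfl

/-- `Bform` as a sum -/
theorem Bform_eq_tsum (u w : U) : Bform u w = ∑' ω, (u : Ω → ℂ) ω * (w : Ω → ℂ) ω := by
  rw [Bform_apply, lp.inner_eq_tsum]
  refine tsum_congr fun ω => ?_
  simp [lp.star_apply, mul_comm]

/-- `Bform` is symmetric -/
theorem Bform_comm (u w : U) : Bform u w = Bform w u := by
  rw [Bform_eq_tsum, Bform_eq_tsum]
  exact tsum_congr fun ω => by ring

/-! ## Flips, signs and conjugation on `U`; invariance of the form -/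

/-- the flip at `n` as a `ℂ`-linear automorphism of `U` -/
def flipU (n : ℕ) : U ≃ₗ[ℂ] U where
  toFun u := ⟨flip n u, flip_mem_Usub n u.2⟩
  invFun u := ⟨flip n u, flip_mem_Usub n u.2⟩
  left_inv u := Subtype.ext (flip_flip n u)
  right_inv u := Subtype.ext (flip_flip n u)
  map_add' u w := Subtype.ext (flip_add n u w)
  map_smul' c u := Subtype.ext (flip_smul n c u)

/-- the sign at `n` as a `ℂ`-linear automorphism of `U` -/
def sgnU (n : ℕ) : U ≃ₗ[ℂ] U where
  toFun u := ⟨sgn n u, sgn_mem_Usub n u.2⟩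
  invFun u := ⟨sgn n u, sgn_mem_Usub n u.2⟩
  left_inv u := Subtype.ext (sgn_sgn n u)
  right_inv u := Subtype.ext (sgn_sgn n u)
  map_add' u w := Subtype.ext (sgn_add n u w)
  map_smul' c u := Subtype.ext (sgn_smul n c u)

/-- `flipU` unfolded -/
@[simp] theorem flipU_apply_coe (n : ℕ) (u : U) : ((flipU n u : U) : Ω → ℂ) = flip n u := rfl
/-- `sgnU` unfolded -/
@[simp] theorem sgnU_apply_coe (n : ℕ) (u : U) : ((sgnU n u : U) : Ω → ℂ) = sgn n u := rfl

/-- the involution `ω ↦ ω Δ {n}` of the configurations -/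
def flipPerm (n : ℕ) : Equiv.Perm Ω := Function.Involutive.toPerm _ (symmDiff_left_involutive ({n} : Finset ℕ))

/-- `flipPerm` unfolded -/
@[simp] theorem flipPerm_apply (n : ℕ) (ω : Ω) : flipPerm n ω = symmDiff ω {n} := rfl

/-- the form is invariant under the flips -/
theorem Bform_flipU (n : ℕ) (u w : U) : Bform (flipU n u) (flipU n w) = Bform u w := by
  rw [Bform_eq_tsum, Bform_eq_tsum]
  have := Equiv.tsum_eq (flipPerm n) (fun ω => (u : Ω → ℂ) ω * (w : Ω → ℂ) ω)
  simp only [flipPerm_apply] at this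
  rw [← this]
  rfl

/-- the form is invariant under the signs -/
theorem Bform_sgnU (n : ℕ) (u w : U) : Bform (sgnU n u) (sgnU n w) = Bform u w := by
  rw [Bform_eq_tsum, Bform_eq_tsum]
  refine tsum_congr fun ω => ?_
  simp only [sgnU_apply_coe, sgn]
  split_ifs <;> ring

/-- pointwise conjugation on `U` -/
def conjU (u : U) : U := ⟨conjF u, conjF_mem_Usub u.2⟩

/-- `conjU` unfolded -/
@[simp] theorem conjU_apply_coe (u : U) : ((conjU u : U) : Ω → ℂ) = conjF u := rfl

/-- `conjU` is additive -/
theorem conjU_add (u w : U) : conjU (u + w) = conjU u + conjU w := Subtype.ext (conjF_add u w)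

/-- `conjU` is antilinear -/
theorem conjU_smul (c : ℂ) (u : U) : conjU (c • u) = (starRingEnd ℂ) c • conjU u :=
  Subtype.ext (conjF_smul c u)

/-- `conjU` is an involution -/
theorem conjU_conjU (u : U) : conjU (conjU u) = u := Subtype.ext (conjF_conjF u)

/-- `conjU` commutes with the flips -/
theorem conjU_flipU (n : ℕ) (u : U) : conjU (flipU n u) = flipU n (conjU u) :=
  Subtype.ext (conjF_flip n u)

/-- `conjU` commutes with the signs -/
theorem conjU_sgnU (n : ℕ) (u : U) : conjU (sgnU n u) = sgnU n (conjU u) :=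
  Subtype.ext (conjF_sgn n u)

/-- the form is conjugated by `conjU` -/
theorem Bform_conjU (u w : U) : Bform (conjU u) (conjU w) = (starRingEnd ℂ) (Bform u w) := by
  rw [Bform_eq_tsum, Bform_eq_tsum, Complex.conj_tsum]
  refine tsum_congr fun ω => ?_
  simp [conjF]

/-- the form of `u` with its conjugate is the squared `ℓ²`-norm -/
theorem Bform_conjU_self (u : U) : Bform u (conjU u) = ((‖toLp u‖ ^ 2 : ℝ) : ℂ) := by
  have h : toLp (conjU u) = star (toLp u) := by
    apply lp.ext; funext ω; simp [lp.star_apply, conjF]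
  rw [Bform_apply, h, inner_self_eq_norm_sq_to_K, norm_star]
  push_cast; rfl

/-! ## The first curve `A₁ = ℂ ⊕ (U × U) ⊕ ℂ·t` -/

/-- `V₁ = U × U`: holomorphic and antiholomorphic copies of `U` -/
abbrev V₁ := U × U

/-- the intersection form of the first curve: `β₁ (u, ū) (u', ū') = Bform u ū' + Bform u' ū` -/
def β₁ : V₁ →ₗ[ℂ] V₁ →ₗ[ℂ] ℂ :=
  LinearMap.mk₂ ℂ (fun v w => Bform v.1 w.2 + Bform w.1 v.2)
    (fun v v' w => by simp only [Prod.fst_add, Prod.snd_add, map_add, LinearMap.add_apply]; ring)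
    (fun c v w => by
      simp only [Prod.smul_fst, Prod.smul_snd, map_smul, LinearMap.smul_apply, smul_eq_mul]; ring)
    (fun v w w' => by simp only [Prod.fst_add, Prod.snd_add, map_add, LinearMap.add_apply]; ring)
    (fun c v w => by
      simp only [Prod.smul_fst, Prod.smul_snd, map_smul, LinearMap.smul_apply, smul_eq_mul]; ring)

/-- `β₁` unfolded -/
theorem β₁_apply (v w : V₁) : β₁ v w = Bform v.1 w.2 + Bform w.1 v.2 := rfl

/-- `β₁` is symmetric -/
theorem β₁_symm (v w : V₁) : β₁ v w = β₁ w v := by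
  rw [β₁_apply, β₁_apply, add_comm]

/-- `β₁` vanishes on two holomorphic classes: a curve has no `(2,0)`-forms -/
theorem β₁_hol (u u' : U) : β₁ (u, 0) (u', 0) = 0 := by
  simp [β₁_apply]

/-- the first curve algebra -/
abbrev A₁ := Curve ℂ V₁ Unit β₁

/-- `A₁` is commutative -/
instance : CommRing A₁ := { (inferInstance : Ring A₁) with mul_comm := Curve.mul_comm' β₁_symm }

/-- the augmentation `A₁ → ℂ`, `x ↦ x.c` -/
def aug : A₁ →+* ℂ where
  toFun x := x.c
  map_one' := rfl
  map_mul' _ _ := rfl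
  map_zero' := rfl
  map_add' _ _ := rfl

/-- `aug` unfolded -/
@[simp] theorem aug_apply (x : A₁) : aug x = x.c := rfl

/-- the holomorphic classes of the first curve, `u ↦ (0, (u, 0), 0)` -/
def holA (u : U) : A₁ := ⟨0, (u, 0), 0, ()⟩

/-- the antiholomorphic classes of the first curve, `u ↦ (0, (0, u), 0)` -/
def antiA (u : U) : A₁ := ⟨0, (0, u), 0, ()⟩

/-- the top class `t₁` of the first curve -/
def topA : A₁ := ⟨0, 0, 1, ()⟩

/-- `holA` is additive -/
theorem holA_add (u w : U) : holA (u + w) = holA u + holA w := by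
  simp only [holA]; ext <;> simp

/-- `holA` is linear -/
theorem holA_smul (z : ℂ) (u : U) : holA (z • u) = z • holA u := by
  simp only [holA]; ext <;> simp

/-- `holA 0 = 0` -/
theorem holA_zero : holA 0 = 0 := by
  simp only [holA]; ext <;> simp

/-- two holomorphic classes multiply to `0` -/
theorem holA_mul_holA (u w : U) : holA u * holA w = 0 := by
  simp only [holA]; ext <;> simp [β₁_hol]

/-- a holomorphic and an antiholomorphic class multiply to `Bform u w • t₁` -/
theorem holA_mul_antiA (u w : U) : holA u * antiA w = Bform u w • topA := by
  simp only [holA, antiA, topA]; ext <;> simp [β₁_apply]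

/-- `holA` is injective -/
theorem holA_injective : Function.Injective holA := by
  intro u w h
  have := congrArg (fun x : A₁ => x.v.1) h
  simpa [holA] using this

/-- the scalars of `A₁` -/
theorem algebraMap_A₁ (z : ℂ) : algebraMap ℂ A₁ z = ⟨z, 0, 0, ()⟩ := by
  ext <;> simp

/-! ## The second curve: `V₂ = (Fin 2 → A₁) × (Fin 2 → A₁)` and `β₂` -/

/-- the degree-`1` part of the second curve over `A₁`: two holomorphic classes `e₀, e₁` and their conjugates -/
abbrev V₂ := (Fin 2 → A₁) × (Fin 2 → A₁)

/-- the intersection form of the second curve: `β₂ (a, b) (a', b') = ∑ k, (a k * b' k + a' k * b k)` -/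
def β₂ : V₂ →ₗ[A₁] V₂ →ₗ[A₁] A₁ :=
  LinearMap.mk₂ A₁ (fun v w => ∑ k, (v.1 k * w.2 k + w.1 k * v.2 k))
    (fun v v' w => by
      simp only [Prod.fst_add, Prod.snd_add, Pi.add_apply, ← Finset.sum_add_distrib]
      refine Finset.sum_congr rfl fun k _ => ?_; ring)
    (fun c v w => by
      simp only [Prod.smul_fst, Prod.smul_snd, Pi.smul_apply, smul_eq_mul, Finset.mul_sum]
      refine Finset.sum_congr rfl fun k _ => ?_; ring)
    (fun v w w' => by
      simp only [Prod.fst_add, Prod.snd_add, Pi.add_apply, ← Finset.sum_add_distrib]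
      refine Finset.sum_congr rfl fun k _ => ?_; ring)
    (fun c v w => by
      simp only [Prod.smul_fst, Prod.smul_snd, Pi.smul_apply, smul_eq_mul, Finset.mul_sum]
      refine Finset.sum_congr rfl fun k _ => ?_; ring)

/-- `β₂` unfolded -/
theorem β₂_apply (v w : V₂) : β₂ v w = ∑ k, (v.1 k * w.2 k + w.1 k * v.2 k) := rfl

/-- `β₂` is symmetric -/
theorem β₂_symm (v w : V₂) : β₂ v w = β₂ w v := by
  rw [β₂_apply, β₂_apply]
  exact Finset.sum_congr rfl fun k _ => by ring

/-! ## The junk summand and the algebra `HXS J` -/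

/-- the square-zero junk summand: a `ℂ`-module `J`, made an `A₁`-module through the augmentation -/
def Junk (J : Type) : Type := J

namespace Junk

variable {J : Type} [AddCommGroup J] [Module ℂ J]

/-- the additive group of `J` -/
instance : AddCommGroup (Junk J) := inferInstanceAs (AddCommGroup J)

/-- the `ℂ`-module structure of `J` -/
instance : Module ℂ (Junk J) := inferInstanceAs (Module ℂ J)

/-- `A₁` acts through the augmentation -/
instance : Module A₁ (Junk J) := Module.compHom (Junk J) aug

/-- the `A₁`-action unfolded -/
theorem smul_def (a : A₁) (j : Junk J) : a • j = a.c • j := rfl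

/-- the scalar tower -/
instance : IsScalarTower ℂ A₁ (Junk J) :=
  ⟨fun z a j => by rw [smul_def, smul_def, Curve.smul_c, smul_eq_mul, mul_smul]⟩

/-- the identification `J → Junk J` (`ℂ`-linear) -/
def mk : J →ₗ[ℂ] Junk J where
  toFun j := j
  map_add' _ _ := rfl
  map_smul' _ _ := rfl

/-- the identification `Junk J → J` (`ℂ`-linear) -/
def val : Junk J →ₗ[ℂ] J where
  toFun j := j
  map_add' _ _ := rfl
  map_smul' _ _ := rfl

/-- `val ∘ mk = id` -/
@[simp] theorem val_mk (j : J) : val (mk j : Junk J) = j := rfl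

/-- `mk ∘ val = id` -/
@[simp] theorem mk_val (j : Junk J) : (mk (val j) : Junk J) = j := rfl

end Junk

/-- the cohomology algebra of the separating datum: the second curve over the first, plus junk -/
abbrev HXS (J : Type) [AddCommGroup J] [Module ℂ J] := Curve A₁ V₂ (Junk J) β₂

section HXS

variable {J : Type} [AddCommGroup J] [Module ℂ J]

/-- `HXS J` is commutative -/
instance : CommRing (HXS J) := { (inferInstance : Ring (HXS J)) with mul_comm := Curve.mul_comm' β₂_symm }

end HXS

end

end Summit.Ventures.HodgeRepro2.Tier7.Line1.Sep
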